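import Literature.NumberTheory.Transcendental.LinEDS
import HarnessLib

/-!
# The linearised extended double shuffle system mod 2: block certificates with GROUPED rows

Extension of the kernel-checkable rank engine `LinEDS` (sibling file `LinEDS.lean`, §9 block
certificates) by rows that are SUMS of extended-double-shuffle rows. Motivation (weight 15): the
mod-2 matrix of Ihara–Kaneko–Zagier's linearised EDS rows `F(s,t)` [IharaKanekoZagier2006, §2]
is block lower triangular by depth, but the plain rows supported in depth `≤ D` need not have full
rank mod 2 on the columns of depth `≤ D` although the whole system has (weight 15: deficiency
`64` at `D = 5`, `6` at `D = 6`, `0` from `D = 7` on; the first closed prefix `(0,7]` has `4068`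
columns, too many for one kernel run). The missing directions ARE integer combinations of plain
rows whose higher-depth parts cancel — found off-line, typically sums of 2–350 rows. A *group* is
such a list of row names; its mod-2 row is the XOR of the rows of its members (`rowBitsG`), the
shadow of the SUM of their integer rows (`entryG`), which is again a valid linear relation at
every group-like solution of Drinfeld's pentagon. `checkBlockG` is `LinEDS.checkBlock` with
groups in place of names; with singleton groups it is the old check (`checkBlockG_singletons`).

References: K. Ihara, M. Kaneko, D. Zagier, Compos. Math. 142 (2006) 307–338, §2, Conjecture 1
[IharaKanekoZagier2006]; M. Kaneko, M. Noro, K. Tsurumaki, IMA Vol. Math. Appl. 148 (2008) 47–58.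
-/

namespace Literature.NumberTheory.Transcendental

namespace LinEDS

/-! ### §10 Grouped rows -/

/-- XOR of a list of bitsets (the mod-2 sum of rows). [folklore] -/
def xorAll : List ℕ → ℕ
  | [] => 0
  | r :: rs => r ^^^ xorAll rs

/-- **The mod-2 row of a group of names** in weight `k`: the XOR of the rows of its members, i.e.
the reduction mod 2 of the sum of their integer EDS rows. [cite: IharaKanekoZagier2006, §2] -/
def rowBitsG (k : ℕ) (g : List (List ℕ × List ℕ)) : ℕ := xorAll (g.map (rowBits k))

/-- **One block of a grouped block certificate**: columns of depth in `(lo, D]`; exactly as many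
groups as block columns, every member name valid; no group row has a bit at a column of depth
`> D` (block triangularity); and the group rows masked to the block, packed in the listed (pivot)
order, eliminate fully (`LinEDS.elimLoop`). [cite: IharaKanekoZagier2006, Conjecture 1] -/
def checkBlockG (k lo D : ℕ) (groups : List (List (List ℕ × List ℕ))) : Bool :=
  let C := colsDepth k lo D
  let mask := maskOf C
  let higher := maskOf (colsDepth k D k)
  let rows := groups.map (rowBitsG k)
  sameLength groups C && groups.all (fun g => g.all (validName k)) &&
    rows.all (fun r => r &&& higher == 0) &&
    elimLoop (2 ^ (k - 1)) (rep (2 ^ (k - 1)) (lengthTR groups)) C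
      (pack (2 ^ (k - 1)) (rows.map (· &&& mask)))

/-- **One grouped block, encoded names** (each group a list of numerals, `decodeName`).
[cite: IharaKanekoZagier2006, Conjecture 1] -/
def checkBlockGEnc (k lo D : ℕ) (codes : List (List ℕ)) : Bool :=
  checkBlockG k lo D (codes.map fun g => g.map decodeName)

/-- **The integer entry of a group** at a column: the sum of the entries of its members (the
integer relation matrix of a grouped certificate). [cite: IharaKanekoZagier2006, §2] -/
noncomputable def entryG (k : ℕ) (g : List (List ℕ × List ℕ)) (c : ℕ) : ℤ :=
  (g.map fun ν => entry k ν c).sum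

/-- `xorAll` of a singleton. [folklore] -/
theorem xorAll_singleton (r : ℕ) : xorAll [r] = r := by
  simp [xorAll]

/-- The row of a singleton group is the row of its name. [folklore] -/
theorem rowBitsG_singleton (k : ℕ) (ν : List ℕ × List ℕ) : rowBitsG k [ν] = rowBits k ν := by
  simp [rowBitsG, xorAll]

/-- `sameLength` is invariant under `map` on the left. [folklore] -/
theorem sameLength_map {α β γ : Type*} (f : α → γ) :
    ∀ (l : List α) (l' : List β), sameLength (l.map f) l' = sameLength l l'
  | [], [] => rfl
  | [], _ :: _ => rfl
  | _ :: _, [] => rfl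
  | _ :: l, _ :: l' => by simp only [List.map_cons, sameLength]; exact sameLength_map f l l'

/-- `lengthTR` is the length. [folklore] -/
theorem lengthTR_eq (α : Type*) (l : List α) : lengthTR l = l.length := by
  unfold lengthTR
  suffices h : ∀ n, l.foldl (fun n _ => n + 1) n = n + l.length by simp [h 0]
  induction l with
  | nil => intro n; simp
  | cons a l ih => intro n; simp only [List.foldl_cons, List.length_cons]; rw [ih]; omega

/-- **Singleton groups give back the plain block check**: a plain block certificate is a grouped
one. [cite: IharaKanekoZagier2006, Conjecture 1] -/
theorem checkBlockG_singletons (k lo D : ℕ) (names : List (List ℕ × List ℕ)) :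
    checkBlockG k lo D (names.map fun ν => [ν]) = checkBlock k lo D names := by
  unfold checkBlockG checkBlock
  simp only [List.map_map, List.all_map, sameLength_map, lengthTR_eq, List.length_map]
  have h1 : (rowBitsG k ∘ fun ν => [ν]) = rowBits k := funext fun ν => rowBitsG_singleton k ν
  have h2 : ((fun g : List (List ℕ × List ℕ) => g.all (validName k)) ∘ fun ν => [ν]) =
      validName k := funext fun ν => by simp
  rw [h1, h2]

/-- Sanity (kernel): in weight `5` the six columns are certified by six singleton groups (the
plain weight-5 certificate), and also by a certificate whose third row is a genuine group of two
names; the same, encoded. [folklore] -/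
theorem checkBlockG_sanity :
    checkBlockG 5 0 4 [[([2], [3])], [([4], [1])], [([3, 1], [1])], [([2], [2, 1])], [([2], [1, 2])],
      [([2, 1, 1], [1])]] = true ∧
    checkBlockG 5 0 4 [[([2], [3])], [([4], [1])], [([3, 1], [1]), ([2, 1], [2])], [([2], [2, 1])],
      [([2], [1, 2])], [([2, 1, 1], [1])]] = true ∧
    checkBlockGEnc 5 0 4 [[5 * 2 ^ 16 + 9], [17 * 2 ^ 16 + 3], [19 * 2 ^ 16 + 3, 11 * 2 ^ 16 + 5],
      [5 * 2 ^ 16 + 11], [5 * 2 ^ 16 + 13], [23 * 2 ^ 16 + 3]] = true := by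
  refine ⟨?_, ?_, ?_⟩ <;> decide +kernel

end LinEDS

end Literature.NumberTheory.Transcendental
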